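import Mathlib.Data.Real.Basic
import Mathlib.Tactic.Linarith
import Mathlib.Tactic.FieldSimp
import Mathlib.Tactic.Ring
import Mathlib.Tactic.Positivity
import HarnessLib

/-!
# Inaccurate line search: Armijo, Goldstein and Wolfe tests (Luenberger–Ye, held copy §7.5)

[LY08] = D. G. Luenberger, Y. Ye, *Linear and Nonlinear Programming* [LuenbergerYe2008], chapter
"Basic descent methods" (numbered 7 in the held copy `book:luenberger2008-linear-nonlinear-programming`,
8 in the Springer 2008 printing), section "Inaccurate line search" (§7.5). With
`φ(α) = f(x_k + αd_k)` and a fixed `ε ∈ (0, 1)`: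
* Armijo's rule: `α` is "not too large" if (24) `φ(α) ≤ φ(0) + εφ'(0)α`, and "not too small" if
  `φ(ηα) > φ(0) + εφ'(0)ηα` for a chosen `η > 1`;
* Goldstein test (`0 < ε < ½`): (24) and (25) `φ(α) > φ(0) + (1 − ε)φ'(0)α`; "in terms of the
  original notation … `ε ≤ (f(x_{k+1}) − f(x_k)) / (α∇f(x_k)d_k) ≤ 1 − ε`";
* Wolfe test (`0 < ε < ½`): (24) and `φ'(α) ≥ (1 − ε)φ'(0)`.

Content recorded: the three tests as predicates on the sampled values (`ArmijoUpper` = (24),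
`GoldsteinLower` = (25), `WolfeCurvature`), the ratio form of the Goldstein bracket
(`goldstein_ratio_iff`: for a descent slope `φ'(0)α < 0` the bracket `ε ≤ ratio ≤ 1 − ε` is exactly
(24) together with the non-strict (25)), and the exact acceptable intervals on the quadratic model
`φ(α) = φ(0) + gα + ½qα²` (`g < 0 < q`) that Fig. 7.8 depicts: (24) ⇔ `α ≤ 2(1 − ε)(−g)/q`
(`armijoUpper_quadratic_iff`), (25) ⇔ `α > 2ε(−g)/q` (`goldsteinLower_quadratic_iff`), Wolfe ⇔
`α ≥ ε(−g)/q` (`wolfe_quadratic_iff`); in particular the exact minimizer `α* = −g/q` passes (24) iff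
`ε ≤ ½` and (25) iff `ε < ½` (`exactStep_armijoUpper_iff`, `exactStep_goldsteinLower_iff`) — the
reason for the restriction `ε < ½` — and always passes the Wolfe curvature test (`exactStep_wolfe`).

Published results only (Lean placement rule): every public declaration carries its
`[cite: LuenbergerYe2008, §7.5 …]` locator (held-copy numbering).
-/

namespace Literature.Analysis.Convex.LineSearchStoppingRules

/-- (24), "not too large": `φ(α) ≤ φ(0) + εφ'(0)α`, on the sampled data `φ0 = φ(0)`, `dφ0 = φ'(0)`,
`φα = φ(α)`. [cite: LuenbergerYe2008, §7.5 (24) Armijo's rule] -/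
def ArmijoUpper (ε φ0 dφ0 α φα : ℝ) : Prop := φα ≤ φ0 + ε * dφ0 * α

/-- (25), Goldstein's "not too small": `φ(α) > φ(0) + (1 − ε)φ'(0)α`.
[cite: LuenbergerYe2008, §7.5 (25) Goldstein test] -/
def GoldsteinLower (ε φ0 dφ0 α φα : ℝ) : Prop := φ0 + (1 - ε) * dφ0 * α < φα

/-- Wolfe's "not too small": `φ'(α) ≥ (1 − ε)φ'(0)` on the sampled slopes.
[cite: LuenbergerYe2008, §7.5 Wolfe test] -/
def WolfeCurvature (ε dφ0 dφα : ℝ) : Prop := (1 - ε) * dφ0 ≤ dφα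

/-- Armijo's "not too small": increasing `α` by the factor `η` makes (24) fail.
[cite: LuenbergerYe2008, §7.5 Armijo's rule] -/
def ArmijoLower (ε η φ0 dφ0 α φηα : ℝ) : Prop := φ0 + ε * dφ0 * (η * α) < φηα

/-- The Goldstein criterion "in terms of the original notation": for a descent step (`φ'(0)α < 0`)
the bracket `ε ≤ (φ(α) − φ(0))/(αφ'(0)) ≤ 1 − ε` is (24) together with the closed form of (25).
[cite: LuenbergerYe2008, §7.5 Goldstein test, display after (25)] -/
theorem goldstein_ratio_iff {ε φ0 dφ0 α φα : ℝ} (hneg : dφ0 * α < 0) :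
    (ε ≤ (φα - φ0) / (α * dφ0) ∧ (φα - φ0) / (α * dφ0) ≤ 1 - ε)
      ↔ (ArmijoUpper ε φ0 dφ0 α φα ∧ φ0 + (1 - ε) * dφ0 * α ≤ φα) := by
  have hneg' : α * dφ0 < 0 := by rwa [mul_comm]
  unfold ArmijoUpper
  rw [le_div_iff_of_neg hneg', div_le_iff_of_neg hneg']
  constructor
  · rintro ⟨h1, h2⟩; constructor <;> nlinarith
  · rintro ⟨h1, h2⟩; constructor <;> nlinarith

/-! ### The quadratic model `φ(α) = φ(0) + gα + ½qα²`, `g < 0 < q` (Fig. 7.8) -/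

/-- The quadratic model of `φ` along the line. [cite: LuenbergerYe2008, §7.5 Fig. 7.8] -/
noncomputable def quadModel (φ0 g q α : ℝ) : ℝ := φ0 + g * α + q / 2 * α ^ 2

/-- (24) on the quadratic model, for `α > 0`: acceptable iff `α ≤ 2(1 − ε)(−g)/q`.
[cite: LuenbergerYe2008, §7.5 (24) and Fig. 7.8(a)] -/
theorem armijoUpper_quadratic_iff {ε φ0 g q α : ℝ} (hq : 0 < q) (hα : 0 < α) :
    ArmijoUpper ε φ0 g α (quadModel φ0 g q α) ↔ α ≤ 2 * (1 - ε) * (-g) / q := by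
  unfold ArmijoUpper quadModel
  rw [le_div_iff₀ hq]
  constructor
  · intro h; nlinarith
  · intro h; nlinarith

/-- (25) on the quadratic model, for `α > 0`: not too small iff `α > 2ε(−g)/q`.
[cite: LuenbergerYe2008, §7.5 (25) and Fig. 7.8(b)] -/
theorem goldsteinLower_quadratic_iff {ε φ0 g q α : ℝ} (hq : 0 < q) (hα : 0 < α) :
    GoldsteinLower ε φ0 g α (quadModel φ0 g q α) ↔ 2 * ε * (-g) / q < α := by
  unfold GoldsteinLower quadModel
  rw [div_lt_iff₀ hq]
  constructor
  · intro h; nlinarith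
  · intro h; nlinarith

/-- Wolfe's curvature test on the quadratic model (`φ'(α) = g + qα`): iff `α ≥ ε(−g)/q`.
[cite: LuenbergerYe2008, §7.5 Wolfe test and Fig. 7.8(c)] -/
theorem wolfe_quadratic_iff {ε g q α : ℝ} (hq : 0 < q) :
    WolfeCurvature ε g (g + q * α) ↔ ε * (-g) / q ≤ α := by
  unfold WolfeCurvature
  rw [div_le_iff₀ hq]
  constructor
  · intro h; nlinarith
  · intro h; nlinarith

/-- The exact minimizer of the quadratic model, `α* = −g/q`, passes (24) iff `ε ≤ ½` — the reason the
tests take `ε < ½`: otherwise even a perfect line search would be rejected.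
[cite: LuenbergerYe2008, §7.5 Goldstein test "0 < ε < ½"] -/
theorem exactStep_armijoUpper_iff {ε φ0 g q : ℝ} (hg : g < 0) (hq : 0 < q) :
    ArmijoUpper ε φ0 g (-g / q) (quadModel φ0 g q (-g / q)) ↔ ε ≤ 1 / 2 := by
  have hα : 0 < -g / q := div_pos (neg_pos.mpr hg) hq
  rw [armijoUpper_quadratic_iff hq hα, div_le_div_iff_of_pos_right hq]
  constructor
  · intro h; nlinarith
  · intro h; nlinarith

/-- … and passes (25) iff `ε < ½`. [cite: LuenbergerYe2008, §7.5 Goldstein test "0 < ε < ½"] -/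
theorem exactStep_goldsteinLower_iff {ε φ0 g q : ℝ} (hg : g < 0) (hq : 0 < q) :
    GoldsteinLower ε φ0 g (-g / q) (quadModel φ0 g q (-g / q)) ↔ ε < 1 / 2 := by
  have hα : 0 < -g / q := div_pos (neg_pos.mpr hg) hq
  rw [goldsteinLower_quadratic_iff hq hα, div_lt_div_iff_of_pos_right hq]
  constructor
  · intro h; nlinarith
  · intro h; nlinarith

/-- … and always passes Wolfe's curvature test (`φ'(α*) = 0 ≥ (1 − ε)φ'(0)` for `ε ≤ 1`).
[cite: LuenbergerYe2008, §7.5 Wolfe test] -/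
theorem exactStep_wolfe {ε g q : ℝ} (hg : g < 0) (hq : 0 < q) (hε : ε ≤ 1) :
    WolfeCurvature ε g (g + q * (-g / q)) := by
  unfold WolfeCurvature
  have : g + q * (-g / q) = 0 := by field_simp; ring
  rw [this]
  nlinarith

/-- (24) and (25) together on the quadratic model pin `α` to the window
`(2ε(−g)/q, 2(1 − ε)(−g)/q]`, which is nonempty exactly when `ε < ½`.
[cite: LuenbergerYe2008, §7.5 Fig. 7.8(b)] -/
theorem goldstein_window_nonempty_iff {ε g q : ℝ} (hg : g < 0) (hq : 0 < q) :
    2 * ε * (-g) / q < 2 * (1 - ε) * (-g) / q ↔ ε < 1 / 2 := by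
  rw [div_lt_div_iff_of_pos_right hq]
  constructor
  · intro h; nlinarith
  · intro h; nlinarith

end Literature.Analysis.Convex.LineSearchStoppingRules
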